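import Literature.Geometry.Kaehler.ComplexTorusHilbertModularCuspStabilizerTranslationAverage
import Literature.Analysis.FunctionSpaces.TorusReflectionCalculus
import HarnessLib

/-!
# `Γ_∞`-equivariance of the `x`-average and the `x`-homotopy; every class of `H^{p+1}((ℍⁿ, Γ_∞))` is
# represented by its `x`-average (Freitag, *Hilbert Modular Forms*, Ch. III §2, proof of Prop. 2.1)

Geometry/Kaehler ∕ NumberTheory/Automorphic support file, sequel of
`…ComplexTorusHilbertModularCuspStabilizerTranslationAverage` (the `x`-average `xAvg η`, the `x`-homotopy `xHom η`
and the homotopy formula `d(xHom η) = η − xAvg η` on `ℍⁿ` for smooth closed `t(Γ)`-periodic forms). Everything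
proved; one definition with body (`scalePoint`), no named fact.

Here the construction is confronted with the full cusp stabilizer `Γ_∞ = stabInfty Γ` of a group with
`HasCuspInfty Γ`: its elements are the maps `z ↦ εz + b` (`γ = (e m; 0 e⁻¹)`, `ε = e²`, acting on `ℂ^{Hom(F,ℝ)}`
through the real embeddings), and Freitag's argument («the form is invariant under `z ↦ εz + b` …», p. 145) is
that the Fourier reduction in `x` is compatible with them:

* §1 the real scalings `scalePoint ε` (`D_ε`): `z ↦ (e m; 0 e⁻¹) z = D_{e²} z + (σ(em))_σ` is affine with
  derivative `D_{e²}` everywhere, so a `Γ_∞`-invariant form satisfies `η(z) = η(γz) ∘ D_ε` for ALL `z`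
  (`apply_eq_comp_scalePoint_of_mem_invariantForms`), and is `t(Γ)`-periodic
  (`isTranslationPeriodic_of_mem_invariantForms`, via `±τ_a ∈ Γ_∞`);
* §2 the multiplier acts on the torus `ℝ^𝐚/ℤ^𝐚` of `x` by the INTEGER MATRIX `M = mulMatrix ε ∈ GL_𝐚(ℤ)`:
  `D_ε ∘ xVec = xVec ∘ M` (`scalePoint_xVec`) and `M · mulMatrix ε⁻¹ = 1` (`mulMatrix_mul_mulMatrix_inv`, by the
  `ℚ`-independence of the lattice basis);
* §3 transport: `xSlice η z = (xSlice η (γz) ∘ M•) ∘ D_ε`, hence — by preservation of the Haar measure under `M•`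
  (`Torus.integral_comp_mulVecT_of_mul_eq_one`), `e_k(M•t) = e_{Mᵀk}(t)` (`Torus.mFourier_mulVecT`) and the weight
  equivariance `σ(ε) W_{Mᵀk,σ} = W_{k,σ}` (`emb_mul_weightVec_transpose_mulVec`) — `xAvg η z = xAvg η (γz) ∘ D_ε`,
  `xCoeff η (Mᵀk) z = xCoeff η k (γz) ∘ D_ε`, `xHom η z = xHom η (γz) ∘ D_ε` (reindexing the series over `GL_𝐚(ℤ)`);
* §4 conclusions: **`xAvg η, xHom η ∈ invariantForms (stabInfty Γ)`**, **`extD (xHom η) = η − xAvg η`** for closed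
  `η`, `η − xAvg η ∈ exactForms`, `xAvg η ∈ closedForms`, and **`[η] = [xAvg η]` in `H^{p+1}((ℍⁿ, Γ_∞))`**
  (`HasCuspInfty.mk_eq_mk_xAvg`): every de Rham class of the cusp stabilizer in positive degree is represented by
  a closed invariant form whose coefficients do not depend on `x` (`xAvg_add_realToPoint`).

## References
* [Freitag1990] E. Freitag, *Hilbert Modular Forms*, Springer (1990): Ch. III §2, Prop. 2.1 and its proof,
  pp. 143–145; Ch. I §2 Remark 2.3, p. 27 (`Λ` acts on `t`).
* [BottTu1982Forms] R. Bott, L. Tu, *Differential Forms in Algebraic Topology*, GTM 82 (1982), §I.4.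
-/

noncomputable section

/- Instance search through the form spaces `Point F [⋀^Fin p]→L[ℝ] ℂ` nests pending instance problems three deep
(see `…HilbertModularInvariantForms`). -/
set_option maxSynthPendingDepth 3

open scoped Matrix MatrixGroups Classical Topology ContDiff
open Set Function Filter MeasureTheory Complex ContinuousAlternatingMap

namespace Literature.Geometry.Kaehler

namespace ComplexTorus

namespace HilbertModularFamily

open _root_.NumberField Module UnitAddTorus
open Literature.NumberTheory.Automorphic.HilbertModular
open Literature.NumberTheory.Automorphic (HilbertModular.deRhamCohomology.mk HilbertModular.deRhamCohomology.mk_eq_mk_iff)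
open Literature.Analysis.FunctionSpaces

variable {F : Type*} [Field F] [NumberField F] [IsTotallyReal F]

/-! ## §1 Real scalings and the affine maps `z ↦ εz + b` of `Γ_∞` -/

section Scale

variable (F) in
/-- **The real scaling `D_ε`**: `w ↦ (σ(ε) w_σ)_σ`, the derivative of `z ↦ εz + b`.
[cite: Freitag1990, Ch. III §2, p. 145 («`z ↦ εz + b`»)] -/
def scalePoint (ε : F) : Point F →L[ℝ] Point F :=
  ContinuousLinearMap.pi fun σ => (σ ε : ℝ) • ContinuousLinearMap.proj σ

omit [NumberField F] [IsTotallyReal F] in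
/-- `(D_ε w)_σ = σ(ε) w_σ`. [cite: Freitag1990, Ch. III §2, p. 145] -/
@[simp]
theorem scalePoint_apply (ε : F) (w : Point F) (σ : F →+* ℝ) : scalePoint F ε w σ = (σ ε : ℂ) * w σ := by
  simp [scalePoint, Complex.real_smul]

omit [NumberField F] [IsTotallyReal F] in
/-- `D_ε` maps real vectors to real vectors: `D_ε x = (σ(ε) x_σ)_σ`. [cite: Freitag1990, Ch. III §2, p. 145] -/
theorem scalePoint_realToPoint (ε : F) (x : (F →+* ℝ) → ℝ) :
    scalePoint F ε (realToPoint F x) = realToPoint F fun σ => σ ε * x σ := by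
  funext σ
  simp

omit [NumberField F] [IsTotallyReal F] in
/-- **`(e m; 0 e⁻¹) z = D_{e²} z + (σ(e m))_σ`**: the cusp stabilizer acts by affine maps.
[cite: Freitag1990, Ch. III §2, p. 145 («`z ↦ εz + b`»); Ch. I §2 (2.1)] -/
theorem moeb_upperTri_eq (e : Fˣ) (m : F) (z : Point F) :
    moeb (upperTri e m) z = scalePoint F ((e ^ 2 : Fˣ) : F) z + realToPoint F (embVec ((e : F) * m)) := by
  funext σ
  rw [moeb_upperTri_apply, Pi.add_apply, scalePoint_apply, realToPoint_apply, embVec_apply, Units.val_pow_eq_pow_val,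
    map_pow, map_mul]
  push_cast
  ring

omit [NumberField F] [IsTotallyReal F] in
/-- `(e m; 0 e⁻¹)(z + v) = (e m; 0 e⁻¹) z + D_{e²} v`. [cite: Freitag1990, Ch. III §2, p. 145] -/
theorem moeb_upperTri_add (e : Fˣ) (m : F) (z v : Point F) :
    moeb (upperTri e m) (z + v) = moeb (upperTri e m) z + scalePoint F ((e ^ 2 : Fˣ) : F) v := by
  rw [moeb_upperTri_eq, moeb_upperTri_eq, map_add]
  abel

omit [IsTotallyReal F] in
/-- The derivative of `z ↦ εz + b` is `D_ε` at every point. [cite: Freitag1990, Ch. III §2, p. 145] -/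
theorem fderiv_moeb_upperTri (e : Fˣ) (m : F) (z : Point F) :
    fderiv ℝ (moeb (upperTri e m)) z = scalePoint F ((e ^ 2 : Fˣ) : F) := by
  have h : moeb (upperTri e m) = fun z => scalePoint F ((e ^ 2 : Fˣ) : F) z + realToPoint F (embVec ((e : F) * m)) :=
    funext (moeb_upperTri_eq e m)
  rw [h]
  exact ((scalePoint F _).hasFDerivAt.add_const _).fderiv

omit [NumberField F] [IsTotallyReal F] in
/-- `z ↦ εz + b` preserves `ℍⁿ` and its complement. [cite: Freitag1990, Ch. I §2 (2.1)] -/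
theorem moeb_upperTri_mem_halfSpace_iff (e : Fˣ) (m : F) (z : Point F) :
    moeb (upperTri e m) z ∈ halfSpace F ↔ z ∈ halfSpace F := by
  refine ⟨fun h σ => ?_, fun h => moeb_mem_halfSpace _ h⟩
  have h1 := h σ
  rw [im_moeb_upperTri] at h1
  exact pos_of_mul_pos_right h1 (sq_nonneg _)

section Algebra

variable {E₁ E₂ E₃ : Type*} [NormedAddCommGroup E₁] [NormedSpace ℝ E₁] [NormedAddCommGroup E₂] [NormedSpace ℝ E₂]
  [NormedAddCommGroup E₃] [NormedSpace ℝ E₃]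

/-- `ι_a(β ∘ L) = (ι_{La} β) ∘ L`. [cite: BottTu1982Forms, §I.4] -/
private theorem curryLeft_compContinuousLinearMap' {q : ℕ} (β : E₂ [⋀^Fin (q + 1)]→L[ℝ] ℂ) (L : E₁ →L[ℝ] E₂) (a : E₁) :
    (β.compContinuousLinearMap L).curryLeft a = (β.curryLeft (L a)).compContinuousLinearMap L := by
  ext v
  simp [ContinuousAlternatingMap.compContinuousLinearMap_apply]

/-- `(c β) ∘ L = c (β ∘ L)` for complex scalars. [folklore] -/
private theorem smul_compContinuousLinearMap' {q : ℕ} (c : ℂ) (β : E₂ [⋀^Fin q]→L[ℝ] ℂ) (L : E₁ →L[ℝ] E₂) :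
    (c • β).compContinuousLinearMap L = c • β.compContinuousLinearMap L := by
  ext v
  simp [ContinuousAlternatingMap.compContinuousLinearMap_apply]

/-- `β ∘ id = β`. [folklore] -/
private theorem compContinuousLinearMap_id' {q : ℕ} (β : E₁ [⋀^Fin q]→L[ℝ] ℂ) :
    β.compContinuousLinearMap (ContinuousLinearMap.id ℝ E₁) = β := by
  ext v
  simp [ContinuousAlternatingMap.compContinuousLinearMap_apply]

/-- `0 ∘ L = 0`. [folklore] -/
private theorem zero_compContinuousLinearMap' {q : ℕ} (L : E₁ →L[ℝ] E₂) :
    (0 : E₂ [⋀^Fin q]→L[ℝ] ℂ).compContinuousLinearMap L = 0 := by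
  ext v
  simp [ContinuousAlternatingMap.compContinuousLinearMap_apply]

/-- Pull-back by a fixed linear map commutes with Bochner integrals. [folklore] -/
private theorem integral_compContinuousLinearMap [CompleteSpace E₁] [CompleteSpace E₂] {q : ℕ} {X : Type*} [MeasureSpace X]
    (L : E₁ →L[ℝ] E₂) {f : X → E₂ [⋀^Fin q]→L[ℝ] ℂ} (hf : Integrable f) :
    ∫ x, (f x).compContinuousLinearMap L = (∫ x, f x).compContinuousLinearMap L := by
  have := (ContinuousAlternatingMap.compContinuousLinearMapCLM (ι := Fin q) (F := ℂ) L :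
    (E₂ [⋀^Fin q]→L[ℝ] ℂ) →L[ℝ] (E₁ [⋀^Fin q]→L[ℝ] ℂ)).integral_comp_comm hf
  simpa only [ContinuousAlternatingMap.compContinuousLinearMapCLM_apply] using this

end Algebra

variable {Γ : Subgroup SL(2, F)}

omit [NumberField F] [IsTotallyReal F] in
/-- **Every element of `Γ_∞` is a `(e m; 0 e⁻¹)`**: to check a property on `Γ_∞` it suffices to check it on these.
[cite: Freitag1990, Ch. I §2 (2.1)] -/
theorem forall_mem_stabInfty {P : SL(2, F) → Prop} (h : ∀ (e : Fˣ) (m : F), upperTri e m ∈ stabInfty Γ → P (upperTri e m)) :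
    ∀ γ ∈ stabInfty Γ, P γ := by
  intro γ hγ
  obtain ⟨e, -, -, heq⟩ := exists_eq_upperTri_of_apply_one_zero hγ.2
  rw [heq] at hγ ⊢
  exact h e _ hγ

omit [NumberField F] [IsTotallyReal F] in
/-- `(e m; 0 e⁻¹) ∈ Γ_∞ ⇒ e² ∈ Λ(Γ)`. [cite: Freitag1990, Ch. I §2 (2.1), Def. of `Λ`] -/
theorem sq_mem_multiplierGroup_of_mem_stabInfty {e : Fˣ} {m : F} (h : upperTri e m ∈ stabInfty Γ) :
    e ^ 2 ∈ multiplierGroup Γ :=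
  ⟨e, m, h.1, rfl⟩

omit [IsTotallyReal F] in
/-- **A `Γ_∞`-invariant form satisfies `η(z) = η(γz) ∘ D_{e²}` at EVERY point** (on `ℍⁿ` by invariance, off `ℍⁿ` both
sides vanish). [cite: Freitag1990, Ch. III §2, p. 142 («`Γ`-invariant»), p. 145] -/
theorem apply_eq_comp_scalePoint_of_mem_invariantForms {Γ' : Subgroup SL(2, F)} {q : ℕ} {η : Form F q}
    (hη : η ∈ invariantForms Γ' q) {e : Fˣ} {m : F} (hγ : upperTri e m ∈ Γ') (z : Point F) :
    η z = (η (moeb (upperTri e m) z)).compContinuousLinearMap (scalePoint F ((e ^ 2 : Fˣ) : F)) := by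
  by_cases hz : z ∈ halfSpace F
  · have h := hη.2.1 _ hγ z hz
    rw [moebPullback_def, fderiv_moeb_upperTri] at h
    exact h.symm
  · have hz' : moeb (upperTri e m) z ∉ halfSpace F := fun h => hz ((moeb_upperTri_mem_halfSpace_iff e m z).1 h)
    rw [hη.2.2 z hz, hη.2.2 _ hz', zero_compContinuousLinearMap']

omit [IsTotallyReal F] in
/-- **`Γ_∞`-invariant forms are `t(Γ)`-periodic** (`±τ_a ∈ Γ_∞` acts by `z ↦ z + a`, with derivative `1`).
[cite: Freitag1990, Ch. III §2, p. 144 («periodic with respect to `t`»)] -/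
theorem isTranslationPeriodic_of_mem_invariantForms {q : ℕ} {η : Form F q} (hη : η ∈ invariantForms (stabInfty Γ) q) :
    IsTranslationPeriodic Γ η := by
  intro a ha z
  have htr : moeb (transl a) = fun w : Point F => w + realToPoint F (embVec a) := funext fun w => by
    rw [moeb_transl]
    rfl
  have key : ∀ γ ∈ stabInfty Γ, moeb γ = moeb (transl a) → η (z + realToPoint F (embVec a)) = η z := by
    intro γ hγ hmo
    by_cases hz : z ∈ halfSpace F
    · have h := hη.2.1 γ hγ z hz
      rw [moebPullback_def, hmo, htr] at h
      simp only at h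
      rw [fderiv_add_const, fderiv_fun_id, compContinuousLinearMap_id'] at h
      exact h
    · rw [hη.2.2 z hz, hη.2.2 _ (fun h => hz ((add_realToPoint_mem_halfSpace_iff z _).1 h))]
  have h10 : (transl a) 1 0 = 0 := by simp [coe_transl]
  rcases ha with h | h
  · exact key _ ⟨h, h10⟩ rfl
  · refine key _ ⟨h, ?_⟩ (funext fun w => moeb_neg _ w)
    simp [Matrix.SpecialLinearGroup.coe_neg, coe_transl]

end Scale

/-! ## §2 The multiplier acts on the torus `ℝ^𝐚/ℤ^𝐚` by an integer matrix of `GL_𝐚(ℤ)` -/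

section LatticeMatrix

variable {Γ : Subgroup SL(2, F)}

omit [IsTotallyReal F] in
/-- Integer coordinates with respect to the lattice basis `α_v` are unique. [cite: Freitag1990, Ch. I §2 2.2, p. 27] -/
theorem HasCuspInfty.intCoords_injective (hΓ : HasCuspInfty Γ) {a b : RealPlace F → ℤ}
    (h : ∑ v, (a v : F) * hΓ.latticeGen v = ∑ v, (b v : F) * hΓ.latticeGen v) : a = b := by
  have hli := hΓ.linearIndependent_latticeGen
  have h0 : ∑ v, ((a v - b v : ℤ) : ℚ) • hΓ.latticeGen v = 0 := by
    have h1 : ∀ v, ((a v - b v : ℤ) : ℚ) • hΓ.latticeGen v = (a v : F) * hΓ.latticeGen v - (b v : F) * hΓ.latticeGen v :=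
      fun v => by
        rw [Int.cast_smul_eq_zsmul, zsmul_eq_mul, Int.cast_sub, sub_mul]
    simp only [h1, Finset.sum_sub_distrib, h, sub_self]
  have h2 := Fintype.linearIndependent_iff.1 hli (fun v => ((a v - b v : ℤ) : ℚ)) h0
  funext v
  have h3 : ((a v - b v : ℤ) : ℚ) = 0 := h2 v
  exact_mod_cast sub_eq_zero.1 (by exact_mod_cast h3 : (a v : ℤ) - b v = 0)

/-- **`mulMatrix ε · mulMatrix ε⁻¹ = 1`**: the multipliers act on `t(Γ)` by matrices of `GL_𝐚(ℤ)`.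
[cite: Freitag1990, Ch. I §2 Remark 2.3, p. 27 («`Λ` acts on `t`»)] -/
theorem HasCuspInfty.mulMatrix_mul_mulMatrix_inv (hΓ : HasCuspInfty Γ) {ε : Fˣ} (hε : ε ∈ multiplierGroup Γ) :
    hΓ.mulMatrix hε * hΓ.mulMatrix (inv_mem hε) = 1 := by
  have hcol : ∀ w, (fun u => (hΓ.mulMatrix hε * hΓ.mulMatrix (inv_mem hε)) u w) =
      fun u => (1 : Matrix (RealPlace F) (RealPlace F) ℤ) u w := by
    intro w
    apply hΓ.intCoords_injective
    have h1 : ∑ u, ((1 : Matrix (RealPlace F) (RealPlace F) ℤ) u w : F) * hΓ.latticeGen u = hΓ.latticeGen w := by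
      simp [Matrix.one_apply]
    have h2 : ∑ u, ((hΓ.mulMatrix hε * hΓ.mulMatrix (inv_mem hε)) u w : F) * hΓ.latticeGen u =
        ∑ v, (hΓ.mulMatrix (inv_mem hε) v w : F) * ((ε : F) * hΓ.latticeGen v) := by
      simp_rw [hΓ.mul_latticeGen_eq hε, Finset.mul_sum, Matrix.mul_apply]
      push_cast
      simp_rw [Finset.sum_mul]
      rw [Finset.sum_comm]
      refine Finset.sum_congr rfl fun v _ => Finset.sum_congr rfl fun u _ => ?_
      ring
    rw [h1, h2]
    calc ∑ v, (hΓ.mulMatrix (inv_mem hε) v w : F) * ((ε : F) * hΓ.latticeGen v)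
        = (ε : F) * ∑ v, (hΓ.mulMatrix (inv_mem hε) v w : F) * hΓ.latticeGen v := by
          rw [Finset.mul_sum]
          exact Finset.sum_congr rfl fun v _ => by ring
      _ = hΓ.latticeGen w := by
          rw [← hΓ.mul_latticeGen_eq (inv_mem hε) w, ← mul_assoc, Units.mul_inv, one_mul]
  exact Matrix.ext fun u w => congrFun (hcol w) u

/-- `mulMatrix ε⁻¹ · mulMatrix ε = 1`. [cite: Freitag1990, Ch. I §2 Remark 2.3, p. 27] -/
theorem HasCuspInfty.mulMatrix_inv_mul_mulMatrix (hΓ : HasCuspInfty Γ) {ε : Fˣ} (hε : ε ∈ multiplierGroup Γ) :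
    hΓ.mulMatrix (inv_mem hε) * hΓ.mulMatrix hε = 1 :=
  mul_eq_one_comm.1 (hΓ.mulMatrix_mul_mulMatrix_inv hε)

/-- **`D_ε ∘ xVec = xVec ∘ M`**: on the torus coordinates of `x`, multiplication by `ε` is the integer matrix
`M = mulMatrix ε` (read as a real matrix). [cite: Freitag1990, Ch. I §2 Remark 2.3, p. 27; Ch. III §2, p. 145] -/
theorem HasCuspInfty.scalePoint_xVec (hΓ : HasCuspInfty Γ) {ε : Fˣ} (hε : ε ∈ multiplierGroup Γ)
    (s : EuclideanSpace ℝ (RealPlace F)) :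
    scalePoint F (ε : F) (hΓ.xVec s) =
      hΓ.xVec (WithLp.toLp 2 (((hΓ.mulMatrix hε).map (Int.cast : ℤ → ℝ)).mulVec (WithLp.ofLp s))) := by
  funext σ
  rw [scalePoint_apply, hΓ.xVec_apply, hΓ.xVec_apply, realToPoint_apply, realToPoint_apply, hΓ.xLin_apply, hΓ.xLin_apply]
  have key : σ (ε : F) * ∑ v, s v * σ (hΓ.latticeGen v) =
      ∑ u, (((hΓ.mulMatrix hε).map (Int.cast : ℤ → ℝ)).mulVec (WithLp.ofLp s)) u * σ (hΓ.latticeGen u) := by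
    have h1 : ∀ v, σ (ε : F) * (s v * σ (hΓ.latticeGen v)) =
        ∑ u, s v * ((hΓ.mulMatrix hε u v : ℝ) * σ (hΓ.latticeGen u)) := fun v => by
      rw [mul_left_comm, ← map_mul, hΓ.mul_latticeGen_eq hε v, _root_.map_sum, Finset.mul_sum]
      refine Finset.sum_congr rfl fun u _ => ?_
      rw [map_mul, map_intCast]
    rw [Finset.mul_sum]
    simp_rw [h1]
    rw [Finset.sum_comm]
    refine Finset.sum_congr rfl fun u _ => ?_
    simp only [Matrix.mulVec, dotProduct, Matrix.map_apply, Finset.sum_mul]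
    exact Finset.sum_congr rfl fun v _ => by ring
  exact_mod_cast key

end LatticeMatrix

/-! ## §3 Transport of the slice, the average, the coefficients and the homotopy under `z ↦ εz + b` -/

section Transport

variable {Γ : Subgroup SL(2, F)}

/-- **The slice transforms by the integer matrix**: `xSlice η z = (xSlice η (γz) ∘ M•) ∘ D_ε` for `γ = (e m; 0 e⁻¹)`,
`ε = e²`, `M = mulMatrix ε`, whenever `η` is `t(Γ)`-periodic and `η = η(γ·) ∘ D_ε`.
[cite: Freitag1990, Ch. III §2, p. 145 («invariant under `z ↦ εz + b`»)] -/
theorem HasCuspInfty.xSlice_eq_comp_of_upperTri (hΓ : HasCuspInfty Γ) {q : ℕ} {η : Form F q} (hη : IsTranslationPeriodic Γ η)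
    {e : Fˣ} {m : F} (hε : e ^ 2 ∈ multiplierGroup Γ)
    (hinv : ∀ z, η z = (η (moeb (upperTri e m) z)).compContinuousLinearMap (scalePoint F ((e ^ 2 : Fˣ) : F)))
    (z : Point F) :
    hΓ.xSlice η z = fun t => (hΓ.xSlice η (moeb (upperTri e m) z)
      (Torus.mulVecT (hΓ.mulMatrix hε) t)).compContinuousLinearMap (scalePoint F ((e ^ 2 : Fˣ) : F)) := by
  funext t
  rw [hΓ.xSlice_apply, hinv, moeb_upperTri_add, hΓ.scalePoint_xVec hε, ← Torus.proj_repr t, Torus.mulVecT_proj,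
    hΓ.xSlice_proj hη, Torus.proj_repr]

/-- **The `x`-average is `Γ_∞`-equivariant**: `xAvg η z = xAvg η (γz) ∘ D_ε` (Haar measure of `ℝ^𝐚/ℤ^𝐚` is
preserved by `M ∈ GL_𝐚(ℤ)`). [cite: Freitag1990, Ch. III §2, p. 145] -/
theorem HasCuspInfty.xAvg_eq_comp_of_upperTri (hΓ : HasCuspInfty Γ) {q : ℕ} {η : Form F q}
    (hηs : ContDiffOn ℝ ∞ η (halfSpace F)) (hη : IsTranslationPeriodic Γ η) (h0 : ∀ z ∉ halfSpace F, η z = 0)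
    {e : Fˣ} {m : F} (hε : e ^ 2 ∈ multiplierGroup Γ)
    (hinv : ∀ z, η z = (η (moeb (upperTri e m) z)).compContinuousLinearMap (scalePoint F ((e ^ 2 : Fˣ) : F)))
    (z : Point F) :
    hΓ.xAvg η z = (hΓ.xAvg η (moeb (upperTri e m) z)).compContinuousLinearMap (scalePoint F ((e ^ 2 : Fˣ) : F)) := by
  by_cases hz : z ∈ halfSpace F
  · have hAz : moeb (upperTri e m) z ∈ halfSpace F := moeb_mem_halfSpace _ hz
    have hS : Continuous (hΓ.xSlice η (moeb (upperTri e m) z)) := (hΓ.isSmooth_xSlice hηs hη hAz).continuous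
    rw [HasCuspInfty.xAvg, hΓ.xSlice_eq_comp_of_upperTri hη hε hinv z]
    rw [Torus.integral_comp_mulVecT_of_mul_eq_one (hΓ.mulMatrix_inv_mul_mulMatrix hε)
      (fun t => (hΓ.xSlice η (moeb (upperTri e m) z) t).compContinuousLinearMap (scalePoint F ((e ^ 2 : Fˣ) : F))),
      integral_compContinuousLinearMap _ hS.integrable_unitAddTorus]
    rfl
  · have hz' : moeb (upperTri e m) z ∉ halfSpace F := fun h => hz ((moeb_upperTri_mem_halfSpace_iff e m z).1 h)
    rw [hΓ.xAvg_eq_zero h0 hz, hΓ.xAvg_eq_zero h0 hz', zero_compContinuousLinearMap']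

/-- **The coefficients are `Γ_∞`-equivariant**: `xCoeff η (Mᵀ k) z = xCoeff η k (γz) ∘ D_ε` (`e_k(M•t) = e_{Mᵀk}(t)`).
[cite: Freitag1990, Ch. III §2, p. 145 («`a_g → a_{gε}`»)] -/
theorem HasCuspInfty.xCoeff_eq_comp_of_upperTri (hΓ : HasCuspInfty Γ) {q : ℕ} {η : Form F q}
    (hηs : ContDiffOn ℝ ∞ η (halfSpace F)) (hη : IsTranslationPeriodic Γ η) (h0 : ∀ z ∉ halfSpace F, η z = 0)
    {e : Fˣ} {m : F} (hε : e ^ 2 ∈ multiplierGroup Γ)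
    (hinv : ∀ z, η z = (η (moeb (upperTri e m) z)).compContinuousLinearMap (scalePoint F ((e ^ 2 : Fˣ) : F)))
    (k : RealPlace F → ℤ) (z : Point F) :
    hΓ.xCoeff η ((hΓ.mulMatrix hε).transpose.mulVec k) z =
      (hΓ.xCoeff η k (moeb (upperTri e m) z)).compContinuousLinearMap (scalePoint F ((e ^ 2 : Fˣ) : F)) := by
  by_cases hz : z ∈ halfSpace F
  · have hAz : moeb (upperTri e m) z ∈ halfSpace F := moeb_mem_halfSpace _ hz
    have hS : Continuous (hΓ.xSlice η (moeb (upperTri e m) z)) := (hΓ.isSmooth_xSlice hηs hη hAz).continuous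
    have hint : Integrable (fun t => mFourier (-k) t • hΓ.xSlice η (moeb (upperTri e m) z) t) :=
      ((mFourier (-k)).continuous.smul hS).integrable_unitAddTorus
    simp only [HasCuspInfty.xCoeff, Torus.mFourierCoeff_eq_integral_volume]
    rw [hΓ.xSlice_eq_comp_of_upperTri hη hε hinv z]
    have h1 : (fun t => mFourier (-((hΓ.mulMatrix hε).transpose.mulVec k)) t •
        (hΓ.xSlice η (moeb (upperTri e m) z) (Torus.mulVecT (hΓ.mulMatrix hε) t)).compContinuousLinearMap
          (scalePoint F ((e ^ 2 : Fˣ) : F))) =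
        fun t => (fun t' => (mFourier (-k) t' • hΓ.xSlice η (moeb (upperTri e m) z) t').compContinuousLinearMap
          (scalePoint F ((e ^ 2 : Fˣ) : F))) (Torus.mulVecT (hΓ.mulMatrix hε) t) := by
      funext t
      simp only [smul_compContinuousLinearMap']
      rw [Torus.mFourier_mulVecT, ← Matrix.mulVec_transpose, Matrix.mulVec_neg]
    rw [h1, Torus.integral_comp_mulVecT_of_mul_eq_one (hΓ.mulMatrix_inv_mul_mulMatrix hε)
      (fun t' => (mFourier (-k) t' • hΓ.xSlice η (moeb (upperTri e m) z) t').compContinuousLinearMap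
        (scalePoint F ((e ^ 2 : Fˣ) : F))),
      integral_compContinuousLinearMap _ hint]
  · have hz' : moeb (upperTri e m) z ∉ halfSpace F := fun h => hz ((moeb_upperTri_mem_halfSpace_iff e m z).1 h)
    rw [hΓ.xCoeff_eq_zero h0 hz, hΓ.xCoeff_eq_zero h0 hz', zero_compContinuousLinearMap']

/-- **The weights absorb the scaling**: `D_ε W_{Mᵀk} = W_k`. [cite: Freitag1990, Ch. III §2, proof of Prop. 2.1, p. 145] -/
theorem HasCuspInfty.scalePoint_wVec (hΓ : HasCuspInfty Γ) {ε : Fˣ} (hε : ε ∈ multiplierGroup Γ) (k : RealPlace F → ℤ) :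
    scalePoint F (ε : F) (hΓ.wVec ((hΓ.mulMatrix hε).transpose.mulVec k)) = hΓ.wVec k := by
  funext σ
  rw [HasCuspInfty.wVec, HasCuspInfty.wVec, scalePoint_apply, realToPoint_apply, realToPoint_apply, ← Complex.ofReal_mul,
    hΓ.emb_mul_weightVec_transpose_mulVec hε k σ]

/-- **The terms of the homotopy are `Γ_∞`-equivariant**: `xHomTerm η (Mᵀk) z = xHomTerm η k (γz) ∘ D_ε`.
[cite: Freitag1990, Ch. III §2, proof of Prop. 2.1, p. 145] -/
theorem HasCuspInfty.xHomTerm_eq_comp_of_upperTri (hΓ : HasCuspInfty Γ) {p : ℕ} {η : Form F (p + 1)}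
    (hηs : ContDiffOn ℝ ∞ η (halfSpace F)) (hη : IsTranslationPeriodic Γ η) (h0 : ∀ z ∉ halfSpace F, η z = 0)
    {e : Fˣ} {m : F} (hε : e ^ 2 ∈ multiplierGroup Γ)
    (hinv : ∀ z, η z = (η (moeb (upperTri e m) z)).compContinuousLinearMap (scalePoint F ((e ^ 2 : Fˣ) : F)))
    (k : RealPlace F → ℤ) (z : Point F) :
    hΓ.xHomTerm η ((hΓ.mulMatrix hε).transpose.mulVec k) z =
      (hΓ.xHomTerm η k (moeb (upperTri e m) z)).compContinuousLinearMap (scalePoint F ((e ^ 2 : Fˣ) : F)) := by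
  rw [HasCuspInfty.xHomTerm, HasCuspInfty.xHomTerm, hΓ.xCoeff_eq_comp_of_upperTri hηs hη h0 hε hinv k z,
    curryLeft_compContinuousLinearMap', hΓ.scalePoint_wVec hε k, smul_compContinuousLinearMap']

/-- The bijection `k ↦ Mᵀ k` of `ℤ^𝐚` (`M ∈ GL_𝐚(ℤ)`). [cite: Freitag1990, Ch. I §2 Remark 2.3, p. 27] -/
def HasCuspInfty.transposeMulVecEquiv (hΓ : HasCuspInfty Γ) {ε : Fˣ} (hε : ε ∈ multiplierGroup Γ) :
    (RealPlace F → ℤ) ≃ (RealPlace F → ℤ) where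
  toFun k := (hΓ.mulMatrix hε).transpose.mulVec k
  invFun k := (hΓ.mulMatrix (inv_mem hε)).transpose.mulVec k
  left_inv k := by
    simp only [Matrix.mulVec_mulVec, ← Matrix.transpose_mul, hΓ.mulMatrix_mul_mulMatrix_inv hε, Matrix.transpose_one,
      Matrix.one_mulVec]
  right_inv k := by
    simp only [Matrix.mulVec_mulVec, ← Matrix.transpose_mul, hΓ.mulMatrix_inv_mul_mulMatrix hε, Matrix.transpose_one,
      Matrix.one_mulVec]

/-- `transposeMulVecEquiv k = Mᵀ k`. [cite: Freitag1990, Ch. I §2 Remark 2.3, p. 27] -/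
theorem HasCuspInfty.transposeMulVecEquiv_apply (hΓ : HasCuspInfty Γ) {ε : Fˣ} (hε : ε ∈ multiplierGroup Γ)
    (k : RealPlace F → ℤ) : hΓ.transposeMulVecEquiv hε k = (hΓ.mulMatrix hε).transpose.mulVec k := rfl

/-- **The `x`-homotopy is `Γ_∞`-equivariant**: `xHom η z = xHom η (γz) ∘ D_ε` (reindex the series along `k ↦ Mᵀk`).
[cite: Freitag1990, Ch. III §2, proof of Prop. 2.1, p. 145] -/
theorem HasCuspInfty.xHom_eq_comp_of_upperTri (hΓ : HasCuspInfty Γ) {p : ℕ} {η : Form F (p + 1)}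
    (hηs : ContDiffOn ℝ ∞ η (halfSpace F)) (hη : IsTranslationPeriodic Γ η) (h0 : ∀ z ∉ halfSpace F, η z = 0)
    {e : Fˣ} {m : F} (hε : e ^ 2 ∈ multiplierGroup Γ)
    (hinv : ∀ z, η z = (η (moeb (upperTri e m) z)).compContinuousLinearMap (scalePoint F ((e ^ 2 : Fˣ) : F)))
    (z : Point F) :
    hΓ.xHom η z = (hΓ.xHom η (moeb (upperTri e m) z)).compContinuousLinearMap (scalePoint F ((e ^ 2 : Fˣ) : F)) := by
  by_cases hz : z ∈ halfSpace F
  · have hAz : moeb (upperTri e m) z ∈ halfSpace F := moeb_mem_halfSpace _ hz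
    have hs := hΓ.summable_xHomTerm hηs hη hAz
    have h1 : hΓ.xHom η z = ∑' k, hΓ.xHomTerm η (hΓ.transposeMulVecEquiv hε k) z :=
      ((hΓ.transposeMulVecEquiv hε).tsum_eq fun k => hΓ.xHomTerm η k z).symm
    rw [h1]
    simp only [hΓ.transposeMulVecEquiv_apply, hΓ.xHomTerm_eq_comp_of_upperTri hηs hη h0 hε hinv]
    have := (ContinuousAlternatingMap.compContinuousLinearMapCLM (ι := Fin p) (F := ℂ) (scalePoint F ((e ^ 2 : Fˣ) : F)) :
      (Point F [⋀^Fin p]→L[ℝ] ℂ) →L[ℝ] (Point F [⋀^Fin p]→L[ℝ] ℂ)).map_tsum hs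
    simp only [ContinuousAlternatingMap.compContinuousLinearMapCLM_apply] at this
    rw [HasCuspInfty.xHom, this]
  · have hz' : moeb (upperTri e m) z ∉ halfSpace F := fun h => hz ((moeb_upperTri_mem_halfSpace_iff e m z).1 h)
    rw [hΓ.xHom_eq_zero h0 hz, hΓ.xHom_eq_zero h0 hz', zero_compContinuousLinearMap']

end Transport

/-! ## §4 `xAvg η`, `xHom η` are `Γ_∞`-invariant; `[η] = [xAvg η]` in `H^{p+1}((ℍⁿ, Γ_∞))` -/

section Main

variable {Γ : Subgroup SL(2, F)}

/-- **`xAvg η ∈ M^q_∞(ℍⁿ)^{Γ_∞}`** for `η ∈ M^q_∞(ℍⁿ)^{Γ_∞}`. [cite: Freitag1990, Ch. III §2, proof of Prop. 2.1, p. 145] -/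
theorem HasCuspInfty.xAvg_mem_invariantForms (hΓ : HasCuspInfty Γ) {q : ℕ} {η : Form F q}
    (hη : η ∈ invariantForms (stabInfty Γ) q) : hΓ.xAvg η ∈ invariantForms (stabInfty Γ) q := by
  have hper := isTranslationPeriodic_of_mem_invariantForms hη
  refine ⟨hΓ.contDiffOn_xAvg hη.1 hper, ?_, fun z hz => hΓ.xAvg_eq_zero hη.2.2 hz⟩
  refine forall_mem_stabInfty fun e m hγ z _ => ?_
  rw [moebPullback_def, fderiv_moeb_upperTri]
  exact (hΓ.xAvg_eq_comp_of_upperTri hη.1 hper hη.2.2 (sq_mem_multiplierGroup_of_mem_stabInfty hγ)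
    (apply_eq_comp_scalePoint_of_mem_invariantForms hη hγ) z).symm

/-- **`xHom η ∈ M^p_∞(ℍⁿ)^{Γ_∞}`** for `η ∈ M^{p+1}_∞(ℍⁿ)^{Γ_∞}`: the homotopy is an ENDOMORPHISM of the complex of
`Γ_∞`-invariant forms (this is where the `Λ`-equivariant weights `W_k = (1/(nσ(ξ_k)))_σ` are needed).
[cite: Freitag1990, Ch. III §2, proof of Prop. 2.1, p. 145] -/
theorem HasCuspInfty.xHom_mem_invariantForms (hΓ : HasCuspInfty Γ) {p : ℕ} {η : Form F (p + 1)}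
    (hη : η ∈ invariantForms (stabInfty Γ) (p + 1)) : hΓ.xHom η ∈ invariantForms (stabInfty Γ) p := by
  have hper := isTranslationPeriodic_of_mem_invariantForms hη
  refine ⟨hΓ.contDiffOn_xHom hη.1 hper, ?_, fun z hz => hΓ.xHom_eq_zero hη.2.2 hz⟩
  refine forall_mem_stabInfty fun e m hγ z _ => ?_
  rw [moebPullback_def, fderiv_moeb_upperTri]
  exact (hΓ.xHom_eq_comp_of_upperTri hη.1 hper hη.2.2 (sq_mem_multiplierGroup_of_mem_stabInfty hγ)
    (apply_eq_comp_scalePoint_of_mem_invariantForms hη hγ) z).symm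

/-- **`d(xHom η) = η − xAvg η` in the complex of `Γ_∞`-invariant forms** (`extD`, the differential extended by
zero off `ℍⁿ`) for a closed `η`. [cite: Freitag1990, Ch. III §2, proof of Prop. 2.1, pp. 144–145] -/
theorem HasCuspInfty.extD_xHom (hΓ : HasCuspInfty Γ) {p : ℕ} {η : Form F (p + 1)} (hη : η ∈ closedForms (stabInfty Γ) (p + 1)) :
    extD (hΓ.xHom η) = η - hΓ.xAvg η := by
  obtain ⟨hηi, hd⟩ := (mem_closedForms_iff (stabInfty Γ) η).1 hη
  have hper := isTranslationPeriodic_of_mem_invariantForms hηi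
  funext z
  by_cases hz : z ∈ halfSpace F
  · rw [extD_of_mem _ hz, hΓ.extDeriv_xHom hηi.1 hper hd hz, Pi.sub_apply]
  · rw [extD_of_not_mem _ hz, Pi.sub_apply, hηi.2.2 z hz, hΓ.xAvg_eq_zero hηi.2.2 hz, sub_zero]

/-- **`η − xAvg η` is exact** in the complex of `Γ_∞`-invariant forms, for closed `η`.
[cite: Freitag1990, Ch. III §2, proof of Prop. 2.1, p. 145] -/
theorem HasCuspInfty.sub_xAvg_mem_exactForms (hΓ : HasCuspInfty Γ) {p : ℕ} {η : Form F (p + 1)}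
    (hη : η ∈ closedForms (stabInfty Γ) (p + 1)) : η - hΓ.xAvg η ∈ exactForms (stabInfty Γ) (p + 1) :=
  (mem_exactForms_succ_iff (stabInfty Γ) _).2
    ⟨hΓ.xHom η, hΓ.xHom_mem_invariantForms (closedForms_le_invariantForms (stabInfty Γ) (p + 1) hη), hΓ.extD_xHom hη⟩

/-- **`xAvg η` is closed** for closed `η` (it differs from `η` by an exact form).
[cite: Freitag1990, Ch. III §2, proof of Prop. 2.1, p. 145] -/
theorem HasCuspInfty.xAvg_mem_closedForms (hΓ : HasCuspInfty Γ) {p : ℕ} {η : Form F (p + 1)}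
    (hη : η ∈ closedForms (stabInfty Γ) (p + 1)) : hΓ.xAvg η ∈ closedForms (stabInfty Γ) (p + 1) := by
  have h := (closedForms (stabInfty Γ) (p + 1)).sub_mem hη
    (exactForms_le_closedForms (stabInfty Γ) (p + 1) (hΓ.sub_xAvg_mem_exactForms hη))
  rwa [sub_sub_cancel] at h

/-- **`[η] = [xAvg η]` in `H^{p+1}((ℍⁿ, Γ_∞))`**: every de Rham class of the cusp stabilizer in positive degree is
represented by a closed invariant form whose coefficients do not depend on `x` (Freitag: «we may assume that the
coefficients … do not depend on `x`»). [cite: Freitag1990, Ch. III §2, proof of Prop. 2.1, p. 145] -/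
theorem HasCuspInfty.mk_eq_mk_xAvg (hΓ : HasCuspInfty Γ) {p : ℕ} {η : Form F (p + 1)}
    (hη : η ∈ closedForms (stabInfty Γ) (p + 1)) :
    HilbertModular.deRhamCohomology.mk (stabInfty Γ) (p + 1) ⟨η, hη⟩ =
      HilbertModular.deRhamCohomology.mk (stabInfty Γ) (p + 1) ⟨hΓ.xAvg η, hΓ.xAvg_mem_closedForms hη⟩ :=
  (HilbertModular.deRhamCohomology.mk_eq_mk_iff (stabInfty Γ) _ _).2 (hΓ.sub_xAvg_mem_exactForms hη)

end Main

end HilbertModularFamily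

end ComplexTorus

end Literature.Geometry.Kaehler
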